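import Mathlib
import HarnessLib
import Summits.NavierStokesRegularity.NavierStokesRegularity.Theorems.PoloidalWindowDoorLrcModEntireRidgeQuasiconvex
import Summits.NavierStokesRegularity.NavierStokesRegularity.Theorems.PoloidalWindowDoorLrcModEntireRidgeSecondOrder
import Summits.NavierStokesRegularity.NavierStokesRegularity.Theorems.PoloidalWindowDoorLrcModEntireLateralLevel
import Summits.NavierStokesRegularity.NavierStokesRegularity.Theorems.PoloidalWindowDoorLrcModEntireRidgeAssembly

/-!
# Item `LrcModEntire` (stmt-NavierStokesRegularity-20428), registry twist_split v7 — the ridge lever in the TIME direction (memo `Cruxes/LrcModEntire/T2B-g14.md` §12):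
# Peakless + joint continuity + tube chart + uniform critical second-order cross-section data in `(n, τ)` ⇒ the DYNAMIC ridge coefficient `θ_τn²/κ + θ_ττ` is quasiconvex along a hot arc

LEAD of item 20428 ns-poloidal-K2-p3 g14 (`--supports stmt-NavierStokesRegularity-20428 --as helper`).  Twin of `…RidgeAssembly.quasiconvexOn_ridgeCoeff_of_peakless` (p706175) with the
height perturbation `z` replaced by the TIME perturbation `τ` (slice `t = −1 + τ`, height `0`): the time pin `∂ₜv₂ = N/2` on the hot set makes the first-order term `c₁τ` CONSTANT
along the arc, so it is subtracted before the expansion.  Inputs: the Peakless binder VERBATIM, joint continuity, a tube chart `e`, plane points `P z₀ q = (q.1,q.2,z₀)`, hot centre /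
cold lateral at `(−1,0)`, and for every arclength `s` the expansion `|σv₂(−1+τ, P 0 (e(s,n))) − (N + c₁τ − ½κ(s)n² + α(s)nτ + ½β(s)τ²)| ≤ C₃(|n|+|τ|)³` with uniform `κ ≥ κ₀ > 0`,
`|α| ≤ A`, `64C₃r ≤ κ₀`.  Conclusion `quasiconvexOn_timeRidgeCoeff_of_peakless`: **`s ↦ α(s)²/κ(s) + β(s)` is `QuasiconvexOn ℝ [a₁,a₂]`** — with `α = σ∂ₜ∂_νv₂`, `β = σ∂ₜₜv₂` at
`γ(s)` these are DYNAMIC quantities (they contain the normal velocity through the ridge and the pressure Hessian, §12).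

WHAT THIS IS NOT: not a claim about Navier–Stokes regularity — a necessary condition on a hypothetical hot ridge (bears_on LADDER-NS N0, item 20428 / crux 19708; both OPEN, ⟨27893⟩ OPEN).
-/

noncomputable section

-- the summit and its single sub-problem share the name (CONVENTIONS §1), as in every Theorems file
set_option linter.dupNamespace false

namespace Summit.NavierStokesRegularity.NavierStokesRegularity.Theorems.PoloidalWindowDoorLrcModEntireRidgeTimeAssembly

open Set Filter Topology Metric Function
open Summit.NavierStokesRegularity.NavierStokesRegularity.Theorems.PoloidalWindowDoorLrcModEntireRidgeQuasiconvex
open Summit.NavierStokesRegularity.NavierStokesRegularity.Theorems.PoloidalWindowDoorLrcModEntireRidgeSecondOrder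
open Summit.NavierStokesRegularity.NavierStokesRegularity.Theorems.PoloidalWindowDoorLrcModEntireLateralLevel
open Summit.NavierStokesRegularity.NavierStokesRegularity.Theorems.PoloidalWindowDoorLrcModEntireRidgeAssembly

variable {v : ℝ → EuclideanSpace ℝ (Fin 3) → EuclideanSpace ℝ (Fin 3)}

/-- **THE DYNAMIC RIDGE COEFFICIENT IS QUASICONVEX ALONG A HOT ARC (time direction).**  See the module docstring. -/
theorem quasiconvexOn_timeRidgeCoeff_of_peakless
    (hpk : ∀ (s z₀ σ M : ℝ) (K O : Set (EuclideanSpace ℝ (Fin 3))), s < 0 →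
      ((σ = 1 ∨ σ = -1) ∧ IsCompact K ∧ K.Nonempty ∧ (∀ y ∈ K, y 2 = z₀ ∧ σ * v s y 2 = M) ∧
        IsOpen O ∧ K ⊆ O ∧ (∀ y ∈ O, y 2 = z₀ → σ * v s y 2 ≤ M) ∧
        (∀ y ∈ O, y 2 = z₀ → σ * v s y 2 = M → y ∈ K)) → False)
    (hcont : ContinuousOn (uncurry v) (Iio (0 : ℝ) ×ˢ univ)) {σ N : ℝ} (hσ : σ = 1 ∨ σ = -1)
    (e : OpenPartialHomeomorph (ℝ × ℝ) (ℝ × ℝ)) {a₁ a₂ r : ℝ} (ha : a₁ ≤ a₂) (hr : 0 < r) (hsrc : Icc a₁ a₂ ×ˢ Icc (-r) r ⊆ e.source)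
    {P : ℝ → ℝ × ℝ → EuclideanSpace ℝ (Fin 3)} (hP : ∀ z₀ q, P z₀ q = WithLp.toLp 2 ![q.1, q.2, z₀])
    (hlat0 : ∀ a ∈ Icc a₁ a₂, ∀ n : ℝ, (n = r ∨ n = -r) → σ * v (-1) (P 0 (e (a, n))) 2 < N)
    (hmid0 : ∀ a ∈ Icc a₁ a₂, σ * v (-1) (P 0 (e (a, 0))) 2 = N)
    {κ α β : ℝ → ℝ} {κ₀ A C₃ : ℝ} (hκ₀ : 0 < κ₀) (hC₃ : 0 ≤ C₃) (hA : 0 ≤ A) (hthin : 64 * C₃ * r ≤ κ₀)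
    (hκ : ∀ s ∈ Icc a₁ a₂, κ₀ ≤ κ s) (hαA : ∀ s ∈ Icc a₁ a₂, |α s| ≤ A)
    {c₁ : ℝ} (hexp : ∀ s ∈ Icc a₁ a₂, ∀ n τ : ℝ,
      |σ * v (-1 + τ) (P 0 (e (s, n))) 2 - (N + c₁ * τ - κ s / 2 * n ^ 2 + α s * n * τ + β s / 2 * τ ^ 2)| ≤ C₃ * (|n| + |τ|) ^ 3) :
    QuasiconvexOn ℝ (Icc a₁ a₂) fun s => α s ^ 2 / κ s + β s := by
  -- (LL): the tube level for all nearby heights at time `−1`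
  obtain ⟨δ, hδ, m, hLL⟩ := lateralLevel_persist hcont e ha hsrc hr.le hP hlat0 hmid0
  -- the cross-section maximum `R s z`
  set R : ℝ → ℝ → ℝ := fun s τ => sSup ((fun n : ℝ => σ * v (-1 + τ) (P 0 (e (s, n))) 2) '' Icc (-r) r) with hR
  -- the admissible height range
  set δ' : ℝ := min (min (δ / 2) (1 / 2)) (κ₀ * r / (A + 1)) with hδ'
  have hδ'0 : 0 < δ' := lt_min (lt_min (by linarith) (by norm_num)) (by positivity)
  have hδ'δ : δ' < δ := lt_of_le_of_lt ((min_le_left _ _).trans (min_le_left _ _)) (by linarith)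
  have hδ'h : δ' ≤ 1 / 2 := (min_le_left _ _).trans (min_le_right _ _)
  have hδ'A : δ' ≤ κ₀ * r / (A + 1) := min_le_right _ _
  -- (Q1): quasiconvexity of `s ↦ R s z` for `|z| < δ`
  have hqc : ∀ τ : ℝ, 0 < |τ| → |τ| ≤ δ' → QuasiconvexOn ℝ (Icc a₁ a₂) fun s => R s τ := by
    intro τ _ hτδ'
    have hτlt : -1 + τ < 0 := by linarith [(abs_le.1 (hτδ'.trans hδ'h)).2]
    obtain ⟨hlat, hmid⟩ := hLL (-1 + τ) 0 (by rw [show -1 + τ + 1 = τ by ring]; exact lt_of_le_of_lt hτδ' hδ'δ) (by simpa using hδ)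
    exact crossSectionMax_quasiconvexOn_of_peakless hpk hτlt hσ (continuous_slice_two hcont hτlt) (hP 0) e hr.le hsrc hlat hmid
  -- (Q2): the uniform expansion of `R s z`
  set C' : ℝ := 16 * C₃ * A ^ 3 / κ₀ ^ 3 + 4 * C₃ with hC'
  have hexpR : ∀ s ∈ Icc a₁ a₂, ∀ z : ℝ, 0 < |z| → |z| ≤ δ' →
      |(R s z + -(c₁ * z)) - N - (α s ^ 2 / κ s + β s) / 2 * z ^ 2| ≤ C' * |z| ^ 3 := by
    intro s hs z hz0 hzδ'
    have hκs : 0 < κ s := lt_of_lt_of_le hκ₀ (hκ s hs)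
    have hthin_s : 64 * C₃ * r ≤ κ s := hthin.trans (hκ s hs)
    -- continuity of the cross-sections at every height
    have hsec : ∀ z' : ℝ, |z'| ≤ |z| → ContinuousOn (fun n : ℝ => σ * v (-1 + z') (P 0 (e (s, n))) 2 + -(c₁ * z')) (Icc (-r) r) := by
      intro z' hz'
      have hz'lt : -1 + z' < 0 := by linarith [(abs_le.1 ((hz'.trans hzδ').trans hδ'h)).2]
      have hPc : Continuous (P 0) := by
        have : P 0 = fun q => WithLp.toLp 2 ![q.1, q.2, (0:ℝ)] := funext (hP 0)
        rw [this]
        refine (PiLp.continuous_toLp 2 _).comp (continuous_pi fun i => ?_)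
        fin_cases i <;> simp <;> fun_prop
      have hline : ContinuousOn (fun n : ℝ => e (s, n)) (Icc (-r) r) :=
        e.continuousOn.comp (Continuous.continuousOn (by fun_prop)) fun n hn => hsrc ⟨hs, hn⟩
      exact (continuousOn_const.mul (((continuous_slice_two hcont hz'lt).comp hPc).comp_continuousOn hline)).add continuousOn_const
    have hαz : |α s| * |z| ≤ κ s * r := by
      have h1 : |α s| * |z| ≤ A * (κ₀ * r / (A + 1)) :=
        mul_le_mul (hαA s hs) (hzδ'.trans hδ'A) (abs_nonneg _) hA
      have h2 : A * (κ₀ * r / (A + 1)) ≤ κ₀ * r := by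
        rw [mul_div_assoc']
        rw [div_le_iff₀ (by linarith)]
        nlinarith [mul_nonneg hκ₀.le hr.le]
      exact h1.trans (h2.trans (mul_le_mul_of_nonneg_right (hκ s hs) hr.le))
    have hexp' : ∀ n z' : ℝ, |n| ≤ r → |z'| ≤ |z| →
        |σ * v (-1 + z') (P 0 (e (s, n))) 2 + -(c₁ * z') - (N - κ s / 2 * n ^ 2 + α s * n * z' + β s / 2 * z' ^ 2)| ≤ C₃ * (|n| + |z'|) ^ 3 := by
      intro n z' _ _
      have h := hexp s hs n z'
      have e : σ * v (-1 + z') (P 0 (e (s, n))) 2 + -(c₁ * z') - (N - κ s / 2 * n ^ 2 + α s * n * z' + β s / 2 * z' ^ 2) =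
          σ * v (-1 + z') (P 0 (e (s, n))) 2 - (N + c₁ * z' - κ s / 2 * n ^ 2 + α s * n * z' + β s / 2 * z' ^ 2) := by ring
      rw [e]; exact h
    have h := abs_sSup_sub_le_of_ridgeExpansion (g := fun n z' => σ * v (-1 + z') (P 0 (e (s, n))) 2 + -(c₁ * z')) (δ := |z|)
      hκs hC₃ hr hthin_s hexp' hsec (le_refl |z|) hαz
    -- the shifted cross-section maximum is the maximum minus the constant
    have hshift : sSup ((fun n : ℝ => σ * v (-1 + z) (P 0 (e (s, n))) 2 + -(c₁ * z)) '' Icc (-r) r) = R s z + -(c₁ * z) := by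
      have himg : (fun n : ℝ => σ * v (-1 + z) (P 0 (e (s, n))) 2 + -(c₁ * z)) '' Icc (-r) r =
          (fun x => x + -(c₁ * z)) '' ((fun n : ℝ => σ * v (-1 + z) (P 0 (e (s, n))) 2) '' Icc (-r) r) := by
        rw [Set.image_image]
      rw [himg]
      have hne' : ((fun n : ℝ => σ * v (-1 + z) (P 0 (e (s, n))) 2) '' Icc (-r) r).Nonempty := ⟨_, 0, ⟨by linarith, hr.le⟩, rfl⟩
      have hbdd : BddAbove ((fun n : ℝ => σ * v (-1 + z) (P 0 (e (s, n))) 2) '' Icc (-r) r) := by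
        have hc0 := hsec z le_rfl
        have hc1 : ContinuousOn (fun n : ℝ => σ * v (-1 + z) (P 0 (e (s, n))) 2) (Icc (-r) r) := by
          have h2 := hc0.sub (continuousOn_const (c := -(c₁ * z)))
          refine h2.congr fun n _ => ?_
          simp
        exact (isCompact_Icc.image_of_continuousOn hc1).bddAbove
      simpa using (Monotone.map_csSup_of_continuousAt (f := fun x => x + -(c₁ * z)) (continuous_id.add continuous_const).continuousAt
        (fun a b hab => by linarith) hne' hbdd).symm
    rw [hshift] at h
    -- uniformise the constant
    have hcoef : (16 * C₃ * |α s| ^ 3 / κ s ^ 3 + 4 * C₃) * |z| ^ 3 ≤ C' * |z| ^ 3 := by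
      refine mul_le_mul_of_nonneg_right ?_ (by positivity)
      rw [hC']
      have h1 : |α s| ^ 3 ≤ A ^ 3 := pow_le_pow_left₀ (abs_nonneg _) (hαA s hs) 3
      have h2 : κ₀ ^ 3 ≤ κ s ^ 3 := pow_le_pow_left₀ hκ₀.le (hκ s hs) 3
      have h3 : 16 * C₃ * |α s| ^ 3 / κ s ^ 3 ≤ 16 * C₃ * A ^ 3 / κ₀ ^ 3 := by
        have hk3 : 0 < κ₀ ^ 3 := by positivity
        have hks3 : 0 < κ s ^ 3 := by positivity
        calc 16 * C₃ * |α s| ^ 3 / κ s ^ 3 ≤ 16 * C₃ * A ^ 3 / κ s ^ 3 :=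
              div_le_div_of_nonneg_right (by nlinarith [mul_nonneg hC₃ (sub_nonneg.2 h1)]) hks3.le
          _ ≤ 16 * C₃ * A ^ 3 / κ₀ ^ 3 := div_le_div_of_nonneg_left (by positivity) hk3 h2
      linarith
    have e1 : R s z + -(c₁ * z) - N - (α s ^ 2 / κ s + β s) / 2 * z ^ 2 = R s z + -(c₁ * z) - (N + (α s ^ 2 / κ s + β s) / 2 * z ^ 2) := by ring
    rw [e1]
    exact h.trans hcoef
  -- (Q2): pass to the coefficient, for the shifted family `R s τ − c₁τ` (an `s`-independent shift keeps quasiconvexity)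
  have hqc' : ∀ z : ℝ, 0 < |z| → |z| ≤ δ' → QuasiconvexOn ℝ (Icc a₁ a₂) fun s => R s z + -(c₁ * z) := fun z hz0 hzδ' => by
    have h := quasiconvexOn_affine_pos (hqc z hz0 hzδ') zero_le_one (-(c₁ * z))
    have e : (fun s => 1 * R s z + -(c₁ * z)) = fun s => R s z + -(c₁ * z) := by funext s'; ring
    rw [e] at h
    exact h
  exact quasiconvexOn_coeff_of_expansion (R := fun s z => R s z + -(c₁ * z)) (convex_Icc a₁ a₂) hδ'0 hexpR hqc'

end Summit.NavierStokesRegularity.NavierStokesRegularity.Theorems.PoloidalWindowDoorLrcModEntireRidgeTimeAssembly
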